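import Mathlib
import HarnessLib

/-!
# The three abstract steps of THEOREM 53.B (imc g41; landed by LEAD p1 g25 from `HOME/imc/g41/Sketch53B.lean` sha16 2d10a7cdcd5ab08a, T-imc-53B)
«Eisenstein multiplicity one in the Shimura sector ⟹ Stevens capture», MEMO-imc P.S. §53.10.

53.B for a newform `f` of level `N` and `λ ∣ ℓ` is the composition of
* `quot_ne_top_of_torsionFree_witness` (Nakayama step): `N_+ := Λ₀/(star-1)Λ₀` is a finitely
  generated module over the order `𝕋_f` (a domain) with a non-torsion element, so `N_+ ≠ λ N_+`
  — this produces the nonzero `f`-isotypic cocycle `ψ : H → 𝔽_ℓ` in the sector;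
* `vanishes_of_finrank_eq_one` (multiplicity one step): if the sector is one-dimensional and
  contains a nonzero `ψ` vanishing on `K = H ∩ V_f^⊥ = H₁(B_f)`, then the Shimura cocycle
  `E_χ` (also in the sector) vanishes on `K`;
* `dvd_card_quotient_of_vanishes` (index step): if `E_χ = χ ∘ Θ` vanishes on `K` with
  `χ : G_N ↠ ZMod ℓ`, then `ℓ ∣ #(G_N ⧸ Θ(K))`, and `G_N ⧸ Θ(K) ≅ Λ₀/Λ₁` by THEOREM 53.A
  (Sketch53.lean), i.e. `ℓ ∣ s_A(f)`.
The Hecke/Atkin–Lehner/star equivariance facts placing `ψ` in the sector are tree-side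
(T-imc-54). Fact-free; Mathlib only.
-/

set_option autoImplicit false

set_option linter.dupNamespace false

namespace Summit.BirchSwinnertonDyer.BirchSwinnertonDyer.Theorems.ManinLocalTwoThree.ShimuraSectorMultiplicityOne

/-- Nakayama step: a finitely generated module over a domain with a non-torsion element is not
`λ`-divisible for any proper ideal `λ`. -/
theorem quot_ne_top_of_torsionFree_witness {O M : Type*} [CommRing O] [AddCommGroup M]
    [Module O M] [Module.Finite O M] (I : Ideal O) (hI : I ≠ ⊤)
    (hm : ∃ m : M, ∀ a : O, a • m = 0 → a = 0) :
    I • (⊤ : Submodule O M) ≠ ⊤ := by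
  intro htop
  obtain ⟨m, hm⟩ := hm
  obtain ⟨r, hr1, hr⟩ := Submodule.exists_sub_one_mem_and_smul_eq_zero_of_fg_of_le_smul I
    (⊤ : Submodule O M) Module.Finite.fg_top (by rw [htop])
  have hr0 : r = 0 := hm r (hr m Submodule.mem_top)
  apply hI
  rw [hr0, zero_sub] at hr1
  exact I.eq_top_of_isUnit_mem hr1 isUnit_one.neg

/-- Multiplicity-one step: in a one-dimensional sector, if some nonzero member vanishes on `K`
then every member vanishes on `K`. Here functionals are additive maps `H →+ F`. -/
theorem vanishes_of_finrank_eq_one {F H : Type*} [Field F] [AddCommGroup H]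
    (S : Submodule F (H →+ F)) (hS : Module.finrank F S = 1)
    {ψ E : H →+ F} (hψ : ψ ∈ S) (hE : E ∈ S) (hψ0 : ψ ≠ 0)
    (K : AddSubgroup H) (hK : ∀ k ∈ K, ψ k = 0) : ∀ k ∈ K, E k = 0 := by
  intro k hk
  have h1 : ∃ c : F, c • (⟨ψ, hψ⟩ : S) = ⟨E, hE⟩ := by
    have hne : (⟨ψ, hψ⟩ : S) ≠ 0 := by
      intro h; apply hψ0; simpa using congrArg Subtype.val h
    exact (finrank_eq_one_iff_of_nonzero' (⟨ψ, hψ⟩ : S) hne).mp hS ⟨E, hE⟩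
  obtain ⟨c, hc⟩ := h1
  have hc' : c • ψ = E := by simpa using congrArg Subtype.val hc
  rw [← hc']
  simp [hK k hk]

/-- Index step: if `χ ∘ Θ` vanishes on `K` and `χ : G →+ ZMod ℓ` is surjective, then
`ℓ ∣ #(G ⧸ Θ(K))`. -/
theorem dvd_card_quotient_of_vanishes {H G : Type*} [AddCommGroup H] [AddCommGroup G]
    {ℓ : ℕ} [NeZero ℓ] (Θ : H →+ G) (χ : G →+ ZMod ℓ) (hχ : Function.Surjective χ)
    (K : AddSubgroup H) (hK : ∀ k ∈ K, χ (Θ k) = 0) :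
    ℓ ∣ Nat.card (G ⧸ K.map Θ) := by
  have hle : K.map Θ ≤ χ.ker := by
    rintro _ ⟨k, hk, rfl⟩
    exact (AddMonoidHom.mem_ker).mpr (hK k hk)
  let χ' : G ⧸ K.map Θ →+ ZMod ℓ := QuotientAddGroup.lift (K.map Θ) χ hle
  have hsurj : Function.Surjective χ' := by
    intro x
    obtain ⟨g, rfl⟩ := hχ x
    exact ⟨(g : G ⧸ K.map Θ), by simp [χ']⟩
  have h := AddSubgroup.card_dvd_of_surjective χ' hsurj
  simpa [Nat.card_zmod] using h

end Summit.BirchSwinnertonDyer.BirchSwinnertonDyer.Theorems.ManinLocalTwoThree.ShimuraSectorMultiplicityOne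

#harness_tags Summit.BirchSwinnertonDyer.BirchSwinnertonDyer.Theorems.ManinLocalTwoThree.ShimuraSectorMultiplicityOne.dvd_card_quotient_of_vanishes
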